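import Literature.Analysis.FluidPDE.Tao2016AveragedNS.SplitCascadeScaleOneBootstrap
import Literature.Analysis.FluidPDE.TaoCascadeScaleOneClose
import HarnessLib

/-!
# The split Prop. 6.5, Prop. 6.13, III: closing the bootstrap and the bounds at present times (port of `TaoCascadeScaleOneClose`)

T. Tao, *Finite time blowup for an averaged three-dimensional Navier–Stokes equation*,
arXiv:1402.0290v3, §6.6, Prop. 6.13 and its proof ((6.120)–(6.125)), with (6.86), (6.91), (6.92).
HONEST FRAMING: statements about the SPLIT cascade model system; nothing here proves the split
Prop. 6.5 and nothing here concerns the true Navier–Stokes equations.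

Split counterpart of `TaoCascadeScaleOneClose.lean` for hypotheses with error constant `C₁/2`, with
the device `|c̃₁| + |Z̃_{c,1}|` as the `c`-level (`SplitCascadeScaleOneAsym.lean`,
`SplitCascadeScaleOneBootstrap.lean`): `abs_c_one_present_le`, `abs_b_one_present_le`,
`rotorPhase_present_le`, `rotorPhase_le_all`, `prop613_bounds` with the tree's constants; the present
source level uses `∫₀^{T⋆}(ã₁² + Z̃²_{a,1}) ≤ P`. Two genuine differences, both in `prop613_bounds`:
the `d̃₁`-Grönwall reads the `d`-row on an asymmetry window (`hw : AsymWindow …`, `T⋆ ≤ T_w`;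
`d_one_linear'`), and the one-sided bound (6.91) keeps the `a`-asymmetry integral
`∫_{τ₀}^t (1+ε₀)^{5/2}ε²e^{-K¹⁰}Z̃²_{a,1}` explicitly (its `n₀`-smallness is NOT a consequence of the
energy bounds — see `SplitCascadeScaleOneSmall.lean`).

## References

* T. Tao, arXiv:1402.0290v3, §6.6 Prop. 6.13, (6.86), (6.91), (6.92), (6.120)–(6.125).
  [`Tao2016AveragedNS`]
-/

noncomputable section

open Set MeasureTheory intervalIntegral Filter Topology
open Literature.Analysis.ODE

namespace Literature.Analysis.FluidPDE

namespace Tao2016AveragedNS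

open TaoCascade

section Close

variable {γ ε₀ K ε C₁ C₂ C₃ : ℝ} {n₀ N : ℤ} {ηp : ℤ → ℝ} {βp : ℕ → ℝ} {τ : ℤ → ℝ} {Xr : Fin 4 → ℤ → ℝ → ℝ} {W : Fin 3 → ℤ → ℝ → ℝ} {Er : ℤ → ℝ → ℝ}

/-! ## Bounds at present times under the bootstrap hypothesis -/

/-- **`c₁` at present times** under the bootstrap bound on `[τ₀, T]` and a present source level `S₁`
(`∫_{τ₀}^t R ≤ S₁` for `t ∈ [0, T⋆]`, from `integral_source_one_present_le`): for `t ∈ [0, min(T, T⋆)]`,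
`|c₁(t)| ≤ e^{(6/100)K^{10}} S₁`. [cite: Tao2016AveragedNS, §6.6 Prop. 6.13 (6.90), (6.122)] -/
theorem RescaledSplitHypotheses.abs_c_one_present_le
    (h : RescaledSplitHypotheses γ ε₀ K ε (C₁ / 2) C₂ C₃ n₀ N ηp βp τ Xr W Er) (hε₀ : 0 < ε₀) (hε₀1 : ε₀ < 1)
    (hε : 0 < ε) (hC₁ : 0 ≤ C₁) (hN : n₀ ≤ N) {T Ts S₁ : ℝ}
    (hΛ : ∀ t ∈ Icc (τ (n₀ - N)) T, ∫ s in (τ (n₀ - N))..t, |Xr 1 1 s| ≤ ε / 100)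
    (hS₁ : ∀ t ∈ Icc 0 Ts,
      ∫ s in (τ (n₀ - N))..t, ((1 + ε₀) ^ ((5 : ℝ) / 2) * ε ^ 2 * Real.exp (-K ^ 10) * (Xr 0 1 s ^ 2 + W 0 1 s ^ 2) +
        4 * C₁ * (1 + ε₀) ^ (-(n₀ : ℝ) / 2) * Real.sqrt (Er 1 s)) ≤ S₁)
    {t : ℝ} (ht : t ∈ Icc 0 Ts) (htT : t ≤ T) :
    |Xr 2 1 t| + |W 1 1 t| ≤ Real.exp (6 / 100 * K ^ 10) * S₁ := by
  have hτ00 : τ (n₀ - N) ≤ 0 := h.tau_init_le hN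
  have h1 := h.abs_c_one_add_absW_le hε₀ hε₀1 hε hC₁ hN hΛ ⟨hτ00.trans ht.1, htT⟩
  exact h1.trans (mul_le_mul_of_nonneg_left (hS₁ t ht) (Real.exp_pos _).le)

/-- **`b₁` at present times** ((6.125) repaired): under the bootstrap bound on `[τ₀, T]`, the source
levels `S₀` (past) and `S₁` (present), the regime bound `Ẽ₁ ≤ 1` on `[0, T⋆]`, (6.86)
`∫_0^{T⋆} a₁² ≤ P`, and `T⋆ ≤ 100`: for `t ∈ [0, min(T, T⋆)]`,
`|b₁(t)| ≤ D_b + 6εP + 100(6ε⁻¹K^{10}(e^{(6/100)K^{10}}S₁)² + 4C₁(1+ε₀)^{-n₀/2})`, with `D_b` the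
constant of `integral_source_b_one_past_le`. [cite: Tao2016AveragedNS, §6.6 Prop. 6.13 (6.125)] -/
theorem RescaledSplitHypotheses.abs_b_one_present_le
    (h : RescaledSplitHypotheses γ ε₀ K ε (C₁ / 2) C₂ C₃ n₀ N ηp βp τ Xr W Er) (hε₀ : 0 < ε₀) (hε₀1 : ε₀ < 1)
    (hK : 1 ≤ K) (hε : 0 < ε) (hC₁ : 0 ≤ C₁) (hC₃ : 0 ≤ C₃) (hN : n₀ ≤ N) {T Ts S₀ S₁ P : ℝ}
    (hS₀0 : 0 ≤ S₀) (hTs : Ts ≤ 100)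
    (hκ : 36 * Real.sqrt 2 * K * ((K ^ 15)⁻¹ * (1 + ε₀) ^ (-(999 : ℝ) / 100) * C₃ *
      geomConst ε₀ ((248 : ℝ) / 100)) ≤ 1)
    (hΛ : ∀ t ∈ Icc (τ (n₀ - N)) T, ∫ s in (τ (n₀ - N))..t, |Xr 1 1 s| ≤ ε / 100)
    (hS₀ : ∀ k, n₀ - N < k → k ≤ 0 → ∀ t ∈ Icc (τ (k - 1)) (τ k),
      ∫ s in (τ (n₀ - N))..t, ((1 + ε₀) ^ ((5 : ℝ) / 2) * ε ^ 2 * Real.exp (-K ^ 10) * (Xr 0 1 s ^ 2 + W 0 1 s ^ 2) +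
        4 * C₁ * (1 + ε₀) ^ (-(n₀ : ℝ) / 2) * Real.sqrt (Er 1 s)) ≤
        S₀ * (1 + ε₀) ^ ((496 : ℝ) / 100 * k))
    (hS₁ : ∀ t ∈ Icc 0 Ts,
      ∫ s in (τ (n₀ - N))..t, ((1 + ε₀) ^ ((5 : ℝ) / 2) * ε ^ 2 * Real.exp (-K ^ 10) * (Xr 0 1 s ^ 2 + W 0 1 s ^ 2) +
        4 * C₁ * (1 + ε₀) ^ (-(n₀ : ℝ) / 2) * Real.sqrt (Er 1 s)) ≤ S₁)
    (hE1 : ∀ t ∈ Icc 0 Ts, Er 1 t ≤ 1) (hP : ∫ s in (0 : ℝ)..Ts, (Xr 0 1 s ^ 2 + W 0 1 s ^ 2) ≤ P)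
    {t : ℝ} (ht : t ∈ Icc 0 Ts) (htT : t ≤ T) :
    |Xr 1 1 t| ≤
      (12 * ε * ((K ^ 30)⁻¹ * C₃ * geomConst ε₀ ((747 : ℝ) / 100)) +
        6 * ε⁻¹ * K ^ 10 * ((Real.exp (6 / 100 * K ^ 10) * S₀) ^ 2 * C₃ * geomConst ε₀ ((741 : ℝ) / 100)) +
        4 * C₁ * (1 + ε₀) ^ (-(n₀ : ℝ) / 2) *
          (Real.exp 1 * (6 * Real.sqrt 2 * K) * cumEnergyConst ε₀ C₃ * C₃ * geomConst ε₀ ((496 : ℝ) / 100))) +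
      6 * ε * P + 100 * (6 * ε⁻¹ * K ^ 10 * (Real.exp (6 / 100 * K ^ 10) * S₁) ^ 2 +
        4 * C₁ * (1 + ε₀) ^ (-(n₀ : ℝ) / 2)) := by
  have h0 : (0 : ℝ) < 1 + ε₀ := by linarith
  have hKpos : 0 < K := by linarith
  have hq6 : (1 + ε₀) ^ ((5 : ℝ) / 2) ≤ 6 := rpow_five_halves_le_six h0.le (by linarith)
  have hτ00 : τ (n₀ - N) ≤ 0 := h.tau_init_le hN
  have hTs0 : 0 ≤ Ts := ht.1.trans ht.2
  have ht100 : t ≤ 100 := ht.2.trans hTs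
  set Rb : ℝ → ℝ := fun s => (1 + ε₀) ^ ((5 : ℝ) / 2) * (ε * (Xr 0 1 s ^ 2 + W 0 1 s ^ 2) + ε⁻¹ * K ^ 10 * (|Xr 2 1 s| + |W 1 1 s|) ^ 2) +
      4 * C₁ * (1 + ε₀) ^ (-(n₀ : ℝ) / 2) * Real.sqrt (Er 1 s) with hRb
  have hRc : ContinuousOn Rb (Icc (τ (n₀ - N)) Ts) := h.continuousOn_source_b_one' C₁ le_rfl
  have hRi : ∀ {x y : ℝ}, τ (n₀ - N) ≤ x → x ≤ y → y ≤ Ts → IntervalIntegrable Rb volume x y :=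
    fun hx hxy hy => (hRc.mono (Icc_subset_Icc hx hy)).intervalIntegrable_of_Icc hxy
  refine (h.abs_b_one_le_integral hε₀ hε₀1 hε hC₁ hN (hτ00.trans ht.1)).trans ?_
  change ∫ s in (τ (n₀ - N))..t, Rb s ≤ _
  rw [← integral_add_adjacent_intervals (hRi le_rfl hτ00 hTs0) (hRi hτ00 ht.1 ht.2)]
  -- past part (empty if `N = n₀`)
  set Db : ℝ := 12 * ε * ((K ^ 30)⁻¹ * C₃ * geomConst ε₀ ((747 : ℝ) / 100)) +
        6 * ε⁻¹ * K ^ 10 * ((Real.exp (6 / 100 * K ^ 10) * S₀) ^ 2 * C₃ * geomConst ε₀ ((741 : ℝ) / 100)) +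
        4 * C₁ * (1 + ε₀) ^ (-(n₀ : ℝ) / 2) *
          (Real.exp 1 * (6 * Real.sqrt 2 * K) * cumEnergyConst ε₀ C₃ * C₃ * geomConst ε₀ ((496 : ℝ) / 100))
    with hDb
  have hDb0 : 0 ≤ Db := by
    have := geomConst_pos hε₀ (s := (747 : ℝ) / 100) (by norm_num)
    have := geomConst_pos hε₀ (s := (741 : ℝ) / 100) (by norm_num)
    have := geomConst_pos hε₀ (s := (496 : ℝ) / 100) (by norm_num)
    have := cumEnergyConst_nonneg hε₀ hC₃
    have hK10 : 0 ≤ K ^ 10 := by positivity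
    positivity
  have hpast : ∫ s in (τ (n₀ - N))..(0 : ℝ), Rb s ≤ Db := by
    rcases eq_or_lt_of_le hN with heq | hlt
    · have hτz : τ (n₀ - N) = 0 := by rw [heq, sub_self, h.tau_zero]
      rw [hτz, intervalIntegral.integral_same]
      exact hDb0
    · have hmem : (0 : ℝ) ∈ Icc (τ (0 - 1)) (τ 0) := by
        refine ⟨?_, by rw [h.tau_zero]⟩
        have := h.tau_lt 0 (by omega) le_rfl
        rw [h.tau_zero] at this
        exact this.le
      have hT0 : (0 : ℝ) ≤ T := ht.1.trans htT
      have hp := h.integral_source_b_one_past_le hε₀ hε₀1 hK hε hC₁ hC₃ hN hS₀0 hκ hΛ hS₀ (k := 0)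
        (by omega) le_rfl hmem hT0
      simpa only [Int.cast_zero, mul_zero, Real.rpow_zero, mul_one] using hp
  -- present part
  have hc1 : ContinuousOn (fun s => Xr 0 1 s ^ 2 + W 0 1 s ^ 2) (Icc 0 Ts) := ((h.continuousOn_X 0 1 hτ00).pow 2).add ((h.continuousOn_W 0 1 hτ00).pow 2)
  have hc2 : ContinuousOn (fun s => (|Xr 2 1 s| + |W 1 1 s|) ^ 2) (Icc 0 Ts) := ((h.continuousOn_X 2 1 hτ00).abs.add (h.continuousOn_W 1 1 hτ00).abs).pow 2
  have hc3 : ContinuousOn (fun s => Real.sqrt (Er 1 s)) (Icc 0 Ts) := (h.continuousOn_E 1 hτ00).sqrt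
  have hi1 : IntervalIntegrable (fun s => Xr 0 1 s ^ 2 + W 0 1 s ^ 2) volume 0 t :=
    (hc1.mono (Icc_subset_Icc le_rfl ht.2)).intervalIntegrable_of_Icc ht.1
  have hi2 : IntervalIntegrable (fun s => (|Xr 2 1 s| + |W 1 1 s|) ^ 2) volume 0 t :=
    (hc2.mono (Icc_subset_Icc le_rfl ht.2)).intervalIntegrable_of_Icc ht.1
  have hi3 : IntervalIntegrable (fun s => Real.sqrt (Er 1 s)) volume 0 t :=
    (hc3.mono (Icc_subset_Icc le_rfl ht.2)).intervalIntegrable_of_Icc ht.1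
  set cM : ℝ := Real.exp (6 / 100 * K ^ 10) * S₁ with hcM
  have hcbd : ∀ s ∈ Icc 0 t, |Xr 2 1 s| + |W 1 1 s| ≤ cM := fun s hs =>
    h.abs_c_one_present_le hε₀ hε₀1 hε hC₁ hN hΛ hS₁ ⟨hs.1, hs.2.trans ht.2⟩ (hs.2.trans htT)
  have hpres : ∫ s in (0 : ℝ)..t, Rb s ≤ 6 * ε * P +
      100 * (6 * ε⁻¹ * K ^ 10 * cM ^ 2 + 4 * C₁ * (1 + ε₀) ^ (-(n₀ : ℝ) / 2)) := by
    have e1 : (fun s => Rb s) = fun s => ((1 + ε₀) ^ ((5 : ℝ) / 2) * ε * (Xr 0 1 s ^ 2 + W 0 1 s ^ 2) +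
          (1 + ε₀) ^ ((5 : ℝ) / 2) * (ε⁻¹ * K ^ 10) * (|Xr 2 1 s| + |W 1 1 s|) ^ 2) +
          4 * C₁ * (1 + ε₀) ^ (-(n₀ : ℝ) / 2) * Real.sqrt (Er 1 s) := by
      ext s; simp only [hRb]; ring
    rw [e1, intervalIntegral.integral_add ((hi1.const_mul _).add (hi2.const_mul _)) (hi3.const_mul _),
      intervalIntegral.integral_add (hi1.const_mul _) (hi2.const_mul _),
      intervalIntegral.integral_const_mul, intervalIntegral.integral_const_mul,
      intervalIntegral.integral_const_mul]
    have hP1 : ∫ s in (0 : ℝ)..t, (Xr 0 1 s ^ 2 + W 0 1 s ^ 2) ≤ P := by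
      refine le_trans ?_ hP
      apply integral_mono_interval le_rfl ht.1 ht.2
      · exact ae_restrict_of_forall_mem measurableSet_Ioc fun s _ => add_nonneg (sq_nonneg _) (sq_nonneg _)
      · exact hc1.intervalIntegrable_of_Icc hTs0
    have hP2 : ∫ s in (0 : ℝ)..t, (|Xr 2 1 s| + |W 1 1 s|) ^ 2 ≤ 100 * cM ^ 2 := by
      have hm : ∫ s in (0 : ℝ)..t, (|Xr 2 1 s| + |W 1 1 s|) ^ 2 ≤ ∫ s in (0 : ℝ)..t, cM ^ 2 := by
        apply integral_mono_on ht.1 hi2 intervalIntegrable_const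
        intro s hs
        have := hcbd s hs
        exact pow_le_pow_left₀ (by positivity) this 2
      rw [intervalIntegral.integral_const, smul_eq_mul] at hm
      have hcM2 : 0 ≤ cM ^ 2 := sq_nonneg _
      nlinarith [ht.1]
    have hP3 : ∫ s in (0 : ℝ)..t, Real.sqrt (Er 1 s) ≤ 100 := by
      have hm : ∫ s in (0 : ℝ)..t, Real.sqrt (Er 1 s) ≤ ∫ s in (0 : ℝ)..t, (1 : ℝ) := by
        apply integral_mono_on ht.1 hi3 intervalIntegrable_const
        intro s hs
        have := hE1 s ⟨hs.1, hs.2.trans ht.2⟩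
        calc Real.sqrt (Er 1 s) ≤ Real.sqrt 1 := Real.sqrt_le_sqrt this
          _ = 1 := Real.sqrt_one
      rw [intervalIntegral.integral_const, smul_eq_mul, mul_one] at hm
      linarith
    have hA1 : 0 ≤ (1 + ε₀) ^ ((5 : ℝ) / 2) * ε := by positivity
    have hA2 : 0 ≤ (1 + ε₀) ^ ((5 : ℝ) / 2) * (ε⁻¹ * K ^ 10) := by positivity
    have hA3 : 0 ≤ 4 * C₁ * (1 + ε₀) ^ (-(n₀ : ℝ) / 2) := by positivity
    have hPnn : 0 ≤ P := le_trans (integral_nonneg hTs0 fun s _ => add_nonneg (sq_nonneg _) (sq_nonneg _)) hP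
    calc (1 + ε₀) ^ ((5 : ℝ) / 2) * ε * (∫ s in (0 : ℝ)..t, (Xr 0 1 s ^ 2 + W 0 1 s ^ 2)) +
          (1 + ε₀) ^ ((5 : ℝ) / 2) * (ε⁻¹ * K ^ 10) * (∫ s in (0 : ℝ)..t, (|Xr 2 1 s| + |W 1 1 s|) ^ 2) +
          4 * C₁ * (1 + ε₀) ^ (-(n₀ : ℝ) / 2) * (∫ s in (0 : ℝ)..t, Real.sqrt (Er 1 s))
        ≤ (1 + ε₀) ^ ((5 : ℝ) / 2) * ε * P + (1 + ε₀) ^ ((5 : ℝ) / 2) * (ε⁻¹ * K ^ 10) * (100 * cM ^ 2) +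
          4 * C₁ * (1 + ε₀) ^ (-(n₀ : ℝ) / 2) * 100 := by
          gcongr
      _ ≤ 6 * ε * P + 6 * (ε⁻¹ * K ^ 10) * (100 * cM ^ 2) + 4 * C₁ * (1 + ε₀) ^ (-(n₀ : ℝ) / 2) * 100 := by
          have e2 : (1 + ε₀) ^ ((5 : ℝ) / 2) * ε * P ≤ 6 * ε * P :=
            mul_le_mul_of_nonneg_right (mul_le_mul_of_nonneg_right hq6 hε.le) hPnn
          have e3 : (1 + ε₀) ^ ((5 : ℝ) / 2) * (ε⁻¹ * K ^ 10) * (100 * cM ^ 2) ≤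
              6 * (ε⁻¹ * K ^ 10) * (100 * cM ^ 2) :=
            mul_le_mul_of_nonneg_right (mul_le_mul_of_nonneg_right hq6 (by positivity)) (by positivity)
          linarith
      _ = _ := by ring
  linarith

/-- **The rotor phase at present times**: `Λ(t) ≤ D_b C₃ geomConst ε₀ (245/100) + t · B` for
`t ∈ [0, min(T, T⋆)]`, where `B` is any level with `|b₁| ≤ B` on `[0, t]`.
[cite: Tao2016AveragedNS, §6.6 Prop. 6.13 (6.121), (6.125)] -/
theorem RescaledSplitHypotheses.rotorPhase_present_le
    (h : RescaledSplitHypotheses γ ε₀ K ε (C₁ / 2) C₂ C₃ n₀ N ηp βp τ Xr W Er) (hε₀ : 0 < ε₀) (hε₀1 : ε₀ < 1)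
    (hK : 1 ≤ K) (hε : 0 < ε) (hC₁ : 0 ≤ C₁) (hC₃ : 0 ≤ C₃) (hN : n₀ ≤ N) {T S₀ B : ℝ} (hS₀0 : 0 ≤ S₀)
    (hκ : 36 * Real.sqrt 2 * K * ((K ^ 15)⁻¹ * (1 + ε₀) ^ (-(999 : ℝ) / 100) * C₃ *
      geomConst ε₀ ((248 : ℝ) / 100)) ≤ 1)
    (hΛ : ∀ t ∈ Icc (τ (n₀ - N)) T, ∫ s in (τ (n₀ - N))..t, |Xr 1 1 s| ≤ ε / 100)
    (hS₀ : ∀ k, n₀ - N < k → k ≤ 0 → ∀ t ∈ Icc (τ (k - 1)) (τ k),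
      ∫ s in (τ (n₀ - N))..t, ((1 + ε₀) ^ ((5 : ℝ) / 2) * ε ^ 2 * Real.exp (-K ^ 10) * (Xr 0 1 s ^ 2 + W 0 1 s ^ 2) +
        4 * C₁ * (1 + ε₀) ^ (-(n₀ : ℝ) / 2) * Real.sqrt (Er 1 s)) ≤
        S₀ * (1 + ε₀) ^ ((496 : ℝ) / 100 * k))
    {t : ℝ} (ht0 : 0 ≤ t) (htT : t ≤ T) (hB : ∀ s ∈ Icc 0 t, |Xr 1 1 s| ≤ B) :
    ∫ s in (τ (n₀ - N))..t, |Xr 1 1 s| ≤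
      (12 * ε * ((K ^ 30)⁻¹ * C₃ * geomConst ε₀ ((747 : ℝ) / 100)) +
        6 * ε⁻¹ * K ^ 10 * ((Real.exp (6 / 100 * K ^ 10) * S₀) ^ 2 * C₃ * geomConst ε₀ ((741 : ℝ) / 100)) +
        4 * C₁ * (1 + ε₀) ^ (-(n₀ : ℝ) / 2) *
          (Real.exp 1 * (6 * Real.sqrt 2 * K) * cumEnergyConst ε₀ C₃ * C₃ * geomConst ε₀ ((496 : ℝ) / 100))) *
      C₃ * geomConst ε₀ ((245 : ℝ) / 100) + t * B := by
  have hτ00 : τ (n₀ - N) ≤ 0 := h.tau_init_le hN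
  have hbc : ContinuousOn (fun s => |Xr 1 1 s|) (Icc (τ (n₀ - N)) t) := (h.continuousOn_X 1 1 le_rfl).abs
  have hbi : ∀ {x y : ℝ}, τ (n₀ - N) ≤ x → x ≤ y → y ≤ t →
      IntervalIntegrable (fun s => |Xr 1 1 s|) volume x y :=
    fun hx hxy hy => (hbc.mono (Icc_subset_Icc hx hy)).intervalIntegrable_of_Icc hxy
  rw [← integral_add_adjacent_intervals (hbi le_rfl hτ00 ht0) (hbi hτ00 ht0 le_rfl)]
  set ΛP : ℝ := (12 * ε * ((K ^ 30)⁻¹ * C₃ * geomConst ε₀ ((747 : ℝ) / 100)) +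
        6 * ε⁻¹ * K ^ 10 * ((Real.exp (6 / 100 * K ^ 10) * S₀) ^ 2 * C₃ * geomConst ε₀ ((741 : ℝ) / 100)) +
        4 * C₁ * (1 + ε₀) ^ (-(n₀ : ℝ) / 2) *
          (Real.exp 1 * (6 * Real.sqrt 2 * K) * cumEnergyConst ε₀ C₃ * C₃ * geomConst ε₀ ((496 : ℝ) / 100))) *
      C₃ * geomConst ε₀ ((245 : ℝ) / 100) with hΛP
  have hΛP0 : 0 ≤ ΛP := by
    have := geomConst_pos hε₀ (s := (747 : ℝ) / 100) (by norm_num)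
    have := geomConst_pos hε₀ (s := (741 : ℝ) / 100) (by norm_num)
    have := geomConst_pos hε₀ (s := (496 : ℝ) / 100) (by norm_num)
    have := geomConst_pos hε₀ (s := (245 : ℝ) / 100) (by norm_num)
    have := cumEnergyConst_nonneg hε₀ hC₃
    have hKpos : 0 < K := by linarith
    have hK10 : 0 ≤ K ^ 10 := by positivity
    positivity
  have hpast : ∫ s in (τ (n₀ - N))..(0 : ℝ), |Xr 1 1 s| ≤ ΛP := by
    rcases eq_or_lt_of_le hN with heq | hlt
    · have hτz : τ (n₀ - N) = 0 := by rw [heq, sub_self, h.tau_zero]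
      rw [hτz, intervalIntegral.integral_same]
      exact hΛP0
    · exact h.rotorPhase_past_le hε₀ hε₀1 hK hε hC₁ hC₃ hlt hS₀0 hκ hΛ hS₀ ⟨hτ00, le_rfl⟩ (ht0.trans htT)
  have hpres : ∫ s in (0 : ℝ)..t, |Xr 1 1 s| ≤ t * B := by
    have hm : ∫ s in (0 : ℝ)..t, |Xr 1 1 s| ≤ ∫ s in (0 : ℝ)..t, B :=
      integral_mono_on ht0 (hbi hτ00 ht0 le_rfl) intervalIntegrable_const fun s hs => hB s hs
    rw [intervalIntegral.integral_const, smul_eq_mul] at hm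
    linarith
  linarith

/-! ## Closing the bootstrap -/

/-- Continuity of the rotor phase `Λ(t) = ∫_{τ₀}^t |b₁|` on `[τ₀, T⋆]`. [cite: Tao2016AveragedNS, §6.6 Prop. 6.13 (6.121)] -/
theorem RescaledSplitHypotheses.continuousOn_rotorPhase
    (h : RescaledSplitHypotheses γ ε₀ K ε (C₁ / 2) C₂ C₃ n₀ N ηp βp τ Xr W Er) (Ts : ℝ) :
    ContinuousOn (fun t => ∫ s in (τ (n₀ - N))..t, |Xr 1 1 s|) (Icc (τ (n₀ - N)) Ts) :=
  continuousOn_primitive_Icc ((h.continuousOn_X 1 1 le_rfl).abs)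

/-- **The bootstrap (6.121) closes ("Thus `τ' = τ`").** On `[0, T⋆]`, `T⋆ ∈ [0, 100]`, assume the
regime bound `Ẽ₁ ≤ 1` and (6.86) `∫_0^{T⋆} a₁² ≤ P`; let `S₀, S₁` be past/present source levels and `B`
a level with `D_b + 6εP + 100(6ε⁻¹K^{10}(e^{(6/100)K^{10}}S₁)² + 4C₁(1+ε₀)^{-n₀/2}) ≤ B`. If
`D_b C₃ geomConst(245/100) + 100 B < ε/100`, then `Λ(t) ≤ ε/100` for every `t ∈ [τ₀, T⋆]`. (Maximal-time
argument: at a first exit time `t' < T⋆` one would have `Λ(t') = ε/100`, while the bounds of this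
and the previous file, valid up to `t'`, give `Λ(t') < ε/100`.)
[cite: Tao2016AveragedNS, §6.6 Prop. 6.13 (6.121)–(6.125)] -/
theorem RescaledSplitHypotheses.rotorPhase_le_all
    (h : RescaledSplitHypotheses γ ε₀ K ε (C₁ / 2) C₂ C₃ n₀ N ηp βp τ Xr W Er) (hε₀ : 0 < ε₀) (hε₀1 : ε₀ < 1)
    (hK : 1 ≤ K) (hε : 0 < ε) (hC₁ : 0 ≤ C₁) (hC₃ : 0 ≤ C₃) (hN : n₀ ≤ N) {Ts S₀ S₁ P B : ℝ}
    (hS₀0 : 0 ≤ S₀) (hTs0 : 0 ≤ Ts) (hTs : Ts ≤ 100)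
    (hκ : 36 * Real.sqrt 2 * K * ((K ^ 15)⁻¹ * (1 + ε₀) ^ (-(999 : ℝ) / 100) * C₃ *
      geomConst ε₀ ((248 : ℝ) / 100)) ≤ 1)
    (hS₀ : ∀ k, n₀ - N < k → k ≤ 0 → ∀ t ∈ Icc (τ (k - 1)) (τ k),
      ∫ s in (τ (n₀ - N))..t, ((1 + ε₀) ^ ((5 : ℝ) / 2) * ε ^ 2 * Real.exp (-K ^ 10) * (Xr 0 1 s ^ 2 + W 0 1 s ^ 2) +
        4 * C₁ * (1 + ε₀) ^ (-(n₀ : ℝ) / 2) * Real.sqrt (Er 1 s)) ≤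
        S₀ * (1 + ε₀) ^ ((496 : ℝ) / 100 * k))
    (hS₁ : ∀ t ∈ Icc 0 Ts,
      ∫ s in (τ (n₀ - N))..t, ((1 + ε₀) ^ ((5 : ℝ) / 2) * ε ^ 2 * Real.exp (-K ^ 10) * (Xr 0 1 s ^ 2 + W 0 1 s ^ 2) +
        4 * C₁ * (1 + ε₀) ^ (-(n₀ : ℝ) / 2) * Real.sqrt (Er 1 s)) ≤ S₁)
    (hE1 : ∀ t ∈ Icc 0 Ts, Er 1 t ≤ 1) (hP : ∫ s in (0 : ℝ)..Ts, (Xr 0 1 s ^ 2 + W 0 1 s ^ 2) ≤ P)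
    (hB : (12 * ε * ((K ^ 30)⁻¹ * C₃ * geomConst ε₀ ((747 : ℝ) / 100)) +
        6 * ε⁻¹ * K ^ 10 * ((Real.exp (6 / 100 * K ^ 10) * S₀) ^ 2 * C₃ * geomConst ε₀ ((741 : ℝ) / 100)) +
        4 * C₁ * (1 + ε₀) ^ (-(n₀ : ℝ) / 2) *
          (Real.exp 1 * (6 * Real.sqrt 2 * K) * cumEnergyConst ε₀ C₃ * C₃ * geomConst ε₀ ((496 : ℝ) / 100))) +
      6 * ε * P + 100 * (6 * ε⁻¹ * K ^ 10 * (Real.exp (6 / 100 * K ^ 10) * S₁) ^ 2 +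
        4 * C₁ * (1 + ε₀) ^ (-(n₀ : ℝ) / 2)) ≤ B)
    (hclose : (12 * ε * ((K ^ 30)⁻¹ * C₃ * geomConst ε₀ ((747 : ℝ) / 100)) +
        6 * ε⁻¹ * K ^ 10 * ((Real.exp (6 / 100 * K ^ 10) * S₀) ^ 2 * C₃ * geomConst ε₀ ((741 : ℝ) / 100)) +
        4 * C₁ * (1 + ε₀) ^ (-(n₀ : ℝ) / 2) *
          (Real.exp 1 * (6 * Real.sqrt 2 * K) * cumEnergyConst ε₀ C₃ * C₃ * geomConst ε₀ ((496 : ℝ) / 100))) *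
      C₃ * geomConst ε₀ ((245 : ℝ) / 100) + 100 * B < ε / 100) :
    ∀ t ∈ Icc (τ (n₀ - N)) Ts, ∫ s in (τ (n₀ - N))..t, |Xr 1 1 s| ≤ ε / 100 := by
  have hτ00 : τ (n₀ - N) ≤ 0 := h.tau_init_le hN
  have hτTs : τ (n₀ - N) ≤ Ts := hτ00.trans hTs0
  set Λ : ℝ → ℝ := fun t => ∫ s in (τ (n₀ - N))..t, |Xr 1 1 s| with hΛdef
  have hΛc : ContinuousOn Λ (Icc (τ (n₀ - N)) Ts) := h.continuousOn_rotorPhase Ts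
  have hΛ0 : Λ (τ (n₀ - N)) ≤ ε / 100 := by
    simp only [hΛdef, intervalIntegral.integral_same]; positivity
  -- the maximal time of the bootstrap
  set t' := maximalTimeP (fun s => Λ s ≤ ε / 100) (τ (n₀ - N)) Ts with ht'
  have ht'mem : t' ∈ Icc (τ (n₀ - N)) Ts := maximalTimeP_mem hτTs hΛ0
  have hgood : ∀ t ∈ Icc (τ (n₀ - N)) t', Λ t ≤ ε / 100 := fun t ht =>
    maximalTimeP_le_const_spec hτTs hΛc hΛ0 ht
  -- the positive constants
  set ΛP : ℝ := (12 * ε * ((K ^ 30)⁻¹ * C₃ * geomConst ε₀ ((747 : ℝ) / 100)) +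
        6 * ε⁻¹ * K ^ 10 * ((Real.exp (6 / 100 * K ^ 10) * S₀) ^ 2 * C₃ * geomConst ε₀ ((741 : ℝ) / 100)) +
        4 * C₁ * (1 + ε₀) ^ (-(n₀ : ℝ) / 2) *
          (Real.exp 1 * (6 * Real.sqrt 2 * K) * cumEnergyConst ε₀ C₃ * C₃ * geomConst ε₀ ((496 : ℝ) / 100))) *
      C₃ * geomConst ε₀ ((245 : ℝ) / 100) with hΛP
  have hB0 : 0 ≤ B := by
    refine le_trans ?_ hB
    have := geomConst_pos hε₀ (s := (747 : ℝ) / 100) (by norm_num)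
    have := geomConst_pos hε₀ (s := (741 : ℝ) / 100) (by norm_num)
    have := geomConst_pos hε₀ (s := (496 : ℝ) / 100) (by norm_num)
    have := cumEnergyConst_nonneg hε₀ hC₃
    have hKpos : 0 < K := by linarith
    have hK10 : 0 ≤ K ^ 10 := by positivity
    have hPnn : 0 ≤ P := le_trans (integral_nonneg hTs0 fun s _ => add_nonneg (sq_nonneg _) (sq_nonneg _)) hP
    positivity
  -- if `t' = Ts` we are done; otherwise derive a contradiction
  by_cases hcase : t' = Ts
  · intro t ht
    exact hgood t (hcase ▸ ht)
  · exfalso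
    have hlt : t' < Ts := lt_of_le_of_ne ht'mem.2 hcase
    have hexit : Λ t' = ε / 100 := eq_of_maximalTimeP_le_const_lt hτTs hΛc hΛ0 hlt
    rcases le_or_gt t' 0 with hneg | hpos
    · -- exit in the past
      rcases eq_or_lt_of_le hN with heq | hNlt
      · -- empty past: `t' = τ₀ = 0`
        have hτz : τ (n₀ - N) = 0 := by rw [heq, sub_self, h.tau_zero]
        have ht'0 : t' = 0 := le_antisymm hneg (hτz ▸ ht'mem.1)
        have : Λ t' = 0 := by simp only [hΛdef, ht'0, hτz, intervalIntegral.integral_same]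
        rw [this] at hexit
        linarith
      · have hb := h.rotorPhase_past_le hε₀ hε₀1 hK hε hC₁ hC₃ hNlt hS₀0 hκ hgood hS₀
          ⟨ht'mem.1, hneg⟩ le_rfl
        have : Λ t' ≤ ΛP := hb
        have h100B : 0 ≤ 100 * B := by positivity
        linarith
    · -- exit in the present
      have hbd : ∀ s ∈ Icc 0 t', |Xr 1 1 s| ≤ B := fun s hs =>
        (h.abs_b_one_present_le hε₀ hε₀1 hK hε hC₁ hC₃ hN hS₀0 hTs hκ hgood hS₀ hS₁ hE1 hP
          ⟨hs.1, hs.2.trans hlt.le⟩ hs.2).trans hB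
      have hb := h.rotorPhase_present_le hε₀ hε₀1 hK hε hC₁ hC₃ hN hS₀0 hκ hgood hS₀ hpos.le le_rfl hbd
      have : Λ t' ≤ ΛP + t' * B := hb
      have ht'B : t' * B ≤ 100 * B := mul_le_mul_of_nonneg_right (hlt.le.trans hTs) hB0
      linarith

/-! ## Prop. 6.13, repaired and explicit -/

/-- **Prop. 6.13 (small `a₁` implies small `b₁, c₁, d₁`), repaired and explicit.** Under the
hypotheses of `rotorPhase_le_all` and the regime bound `Ẽ₂ ≤ K^{-30}` on `[0, T⋆]`, for every
`t ∈ [0, T⋆]`: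
(6.89) `|b₁(t)| ≤ B`; (6.90) `|c₁(t)| ≤ e^{(6/100)K^{10}} S₁`;
(6.91) `c₁(t) ≥ -e^{(6/100)K^{10}} · 4C₁(1+ε₀)^{-n₀/2} (Ξ C₃ geomConst(496/100) + 100)`;
(6.92) `|d₁(t)| ≤ (√2K^{-15} + 100(6√2 ε⁻² e^{(6/100)K^{10}} S₁ + 4C₁(1+ε₀)^{-n₀/2})) · e^{3600√2 K^{-14}}`.
In the regime of Prop. 6.5 (`K` large, `ε` small, `n₀` large) these are
`O(K^{-1/4}ε)`, `O(K^{-1/4}e^{-(94/100)K^{10}}ε²) ≤ 10⁻⁵e^{-K^{10}/2}ε²`, `-O((1+ε₀)^{-n₀/3})`, `O(K^{-15})`.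
[cite: Tao2016AveragedNS, §6.6 Prop. 6.13 (6.89)–(6.92)] -/
theorem RescaledSplitHypotheses.prop613_bounds
    (h : RescaledSplitHypotheses γ ε₀ K ε (C₁ / 2) C₂ C₃ n₀ N ηp βp τ Xr W Er) (hε₀ : 0 < ε₀) (hε₀1 : ε₀ < 1)
    (hK : 1 ≤ K) (hε : 0 < ε) (hC₁ : 0 ≤ C₁) (hC₃ : 0 ≤ C₃) (hN : n₀ ≤ N) {Ts S₀ S₁ P B : ℝ}
    (hS₀0 : 0 ≤ S₀) (hTs0 : 0 ≤ Ts) (hTs : Ts ≤ 100)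
    (hκ : 36 * Real.sqrt 2 * K * ((K ^ 15)⁻¹ * (1 + ε₀) ^ (-(999 : ℝ) / 100) * C₃ *
      geomConst ε₀ ((248 : ℝ) / 100)) ≤ 1)
    (hS₀ : ∀ k, n₀ - N < k → k ≤ 0 → ∀ t ∈ Icc (τ (k - 1)) (τ k),
      ∫ s in (τ (n₀ - N))..t, ((1 + ε₀) ^ ((5 : ℝ) / 2) * ε ^ 2 * Real.exp (-K ^ 10) * (Xr 0 1 s ^ 2 + W 0 1 s ^ 2) +
        4 * C₁ * (1 + ε₀) ^ (-(n₀ : ℝ) / 2) * Real.sqrt (Er 1 s)) ≤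
        S₀ * (1 + ε₀) ^ ((496 : ℝ) / 100 * k))
    (hS₁ : ∀ t ∈ Icc 0 Ts,
      ∫ s in (τ (n₀ - N))..t, ((1 + ε₀) ^ ((5 : ℝ) / 2) * ε ^ 2 * Real.exp (-K ^ 10) * (Xr 0 1 s ^ 2 + W 0 1 s ^ 2) +
        4 * C₁ * (1 + ε₀) ^ (-(n₀ : ℝ) / 2) * Real.sqrt (Er 1 s)) ≤ S₁)
    (hE1 : ∀ t ∈ Icc 0 Ts, Er 1 t ≤ 1) (hE2 : ∀ t ∈ Icc 0 Ts, Er 2 t ≤ (K ^ 30)⁻¹)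
    (hP : ∫ s in (0 : ℝ)..Ts, (Xr 0 1 s ^ 2 + W 0 1 s ^ 2) ≤ P)
    {Tw ζ : ℝ} (hw : AsymWindow ε₀ K ε C₁ n₀ W Tw ζ) (hTw : Ts ≤ Tw)
    (hB : (12 * ε * ((K ^ 30)⁻¹ * C₃ * geomConst ε₀ ((747 : ℝ) / 100)) +
        6 * ε⁻¹ * K ^ 10 * ((Real.exp (6 / 100 * K ^ 10) * S₀) ^ 2 * C₃ * geomConst ε₀ ((741 : ℝ) / 100)) +
        4 * C₁ * (1 + ε₀) ^ (-(n₀ : ℝ) / 2) *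
          (Real.exp 1 * (6 * Real.sqrt 2 * K) * cumEnergyConst ε₀ C₃ * C₃ * geomConst ε₀ ((496 : ℝ) / 100))) +
      6 * ε * P + 100 * (6 * ε⁻¹ * K ^ 10 * (Real.exp (6 / 100 * K ^ 10) * S₁) ^ 2 +
        4 * C₁ * (1 + ε₀) ^ (-(n₀ : ℝ) / 2)) ≤ B)
    (hclose : (12 * ε * ((K ^ 30)⁻¹ * C₃ * geomConst ε₀ ((747 : ℝ) / 100)) +
        6 * ε⁻¹ * K ^ 10 * ((Real.exp (6 / 100 * K ^ 10) * S₀) ^ 2 * C₃ * geomConst ε₀ ((741 : ℝ) / 100)) +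
        4 * C₁ * (1 + ε₀) ^ (-(n₀ : ℝ) / 2) *
          (Real.exp 1 * (6 * Real.sqrt 2 * K) * cumEnergyConst ε₀ C₃ * C₃ * geomConst ε₀ ((496 : ℝ) / 100))) *
      C₃ * geomConst ε₀ ((245 : ℝ) / 100) + 100 * B < ε / 100)
    {t : ℝ} (ht : t ∈ Icc 0 Ts) :
    |Xr 1 1 t| ≤ B ∧
    |Xr 2 1 t| + |W 1 1 t| ≤ Real.exp (6 / 100 * K ^ 10) * S₁ ∧
    -(Real.exp (6 / 100 * K ^ 10) * (4 * C₁ * (1 + ε₀) ^ (-(n₀ : ℝ) / 2) *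
      (Real.exp 1 * (6 * Real.sqrt 2 * K) * cumEnergyConst ε₀ C₃ * C₃ * geomConst ε₀ ((496 : ℝ) / 100) +
        100) +
      ∫ s in (τ (n₀ - N))..t, (1 + ε₀) ^ ((5 : ℝ) / 2) * ε ^ 2 * Real.exp (-K ^ 10) * W 0 1 s ^ 2)) ≤
      Xr 2 1 t ∧
    |Xr 3 1 t| ≤ (Real.sqrt 2 * (K ^ 15)⁻¹ +
      100 * (6 * Real.sqrt 2 * (ε ^ 2)⁻¹ * (Real.exp (6 / 100 * K ^ 10) * S₁) +
        4 * C₁ * (1 + ε₀) ^ (-(n₀ : ℝ) / 2))) * Real.exp (3600 * Real.sqrt 2 * (K ^ 14)⁻¹) := by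
  have h0 : (0 : ℝ) < 1 + ε₀ := by linarith
  have hKpos : 0 < K := by linarith
  have hq6 : (1 + ε₀) ^ ((5 : ℝ) / 2) ≤ 6 := rpow_five_halves_le_six h0.le (by linarith)
  have hτ00 : τ (n₀ - N) ≤ 0 := h.tau_init_le hN
  -- the bootstrap holds on all of `[τ₀, T⋆]`
  have hΛ := h.rotorPhase_le_all hε₀ hε₀1 hK hε hC₁ hC₃ hN hS₀0 hTs0 hTs hκ hS₀ hS₁ hE1 hP hB hclose
  set cM : ℝ := Real.exp (6 / 100 * K ^ 10) * S₁ with hcM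
  have hb : ∀ s ∈ Icc 0 Ts, |Xr 1 1 s| ≤ B := fun s hs =>
    (h.abs_b_one_present_le hε₀ hε₀1 hK hε hC₁ hC₃ hN hS₀0 hTs hκ hΛ hS₀ hS₁ hE1 hP hs hs.2).trans hB
  have hcW : ∀ s ∈ Icc 0 Ts, |Xr 2 1 s| + |W 1 1 s| ≤ cM := fun s hs =>
    h.abs_c_one_present_le hε₀ hε₀1 hε hC₁ hN hΛ hS₁ hs hs.2
  have hc : ∀ s ∈ Icc 0 Ts, |Xr 2 1 s| ≤ cM := fun s hs =>
    le_trans (le_add_of_nonneg_right (abs_nonneg _)) (hcW s hs)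
  refine ⟨hb t ht, hcW t ht, ?_, ?_⟩
  · -- (6.91), keeping the `a`-asymmetry integral
    have h1 := h.c_one_ge_neg' hε₀ hε₀1 hε hC₁ hN hΛ ⟨hτ00.trans ht.1, ht.2⟩
    -- bound `∫_{τ₀}^t √Ẽ₁ ≤ Ξ C₃ G496 + 100`
    set Ξ := Real.exp 1 * (6 * Real.sqrt 2 * K) * cumEnergyConst ε₀ C₃ with hΞ
    have hΞ0 : 0 ≤ Ξ := by have := cumEnergyConst_nonneg hε₀ hC₃; positivity
    have hG0 : 0 ≤ Ξ * C₃ * geomConst ε₀ ((496 : ℝ) / 100) := by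
      have := geomConst_pos hε₀ (s := (496 : ℝ) / 100) (by norm_num); positivity
    have hsc : ContinuousOn (fun s => Real.sqrt (Er 1 s)) (Icc (τ (n₀ - N)) Ts) :=
      (h.continuousOn_E 1 le_rfl).sqrt
    have hsi : ∀ {x y : ℝ}, τ (n₀ - N) ≤ x → x ≤ y → y ≤ Ts →
        IntervalIntegrable (fun s => Real.sqrt (Er 1 s)) volume x y :=
      fun hx hxy hy => (hsc.mono (Icc_subset_Icc hx hy)).intervalIntegrable_of_Icc hxy
    have hint : ∫ s in (τ (n₀ - N))..t, Real.sqrt (Er 1 s) ≤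
        Ξ * C₃ * geomConst ε₀ ((496 : ℝ) / 100) + 100 := by
      rw [← integral_add_adjacent_intervals (hsi le_rfl hτ00 hTs0) (hsi hτ00 ht.1 ht.2)]
      have hpast : ∫ s in (τ (n₀ - N))..(0 : ℝ), Real.sqrt (Er 1 s) ≤
          Ξ * C₃ * geomConst ε₀ ((496 : ℝ) / 100) := by
        rcases eq_or_lt_of_le hN with heq | hlt
        · have hτz : τ (n₀ - N) = 0 := by rw [heq, sub_self, h.tau_zero]
          rw [hτz, intervalIntegral.integral_same]; exact hG0
        · have hm3 := h.integral_past_le hε₀ hC₃ ((h.continuousOn_E 1 le_rfl).sqrt) (D := Ξ)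
            (s := (496 : ℝ) / 100) hΞ0 (by norm_num) (fun j hj hj0 s hs => by
              have := h.sqrt_energy_one_past_le_improved hε₀ hε₀1 hK hC₃ hκ hj hj0 hs
              convert this using 2; norm_num) (k := 0) (by omega) le_rfl
          rw [h.tau_zero] at hm3
          simpa only [Int.cast_zero, mul_zero, Real.rpow_zero, mul_one] using hm3
      have hpres : ∫ s in (0 : ℝ)..t, Real.sqrt (Er 1 s) ≤ 100 := by
        have hm : ∫ s in (0 : ℝ)..t, Real.sqrt (Er 1 s) ≤ ∫ s in (0 : ℝ)..t, (1 : ℝ) := by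
          apply integral_mono_on ht.1 (hsi hτ00 ht.1 ht.2) intervalIntegrable_const
          intro s hs
          have := hE1 s ⟨hs.1, hs.2.trans ht.2⟩
          calc Real.sqrt (Er 1 s) ≤ Real.sqrt 1 := Real.sqrt_le_sqrt this
            _ = 1 := Real.sqrt_one
        rw [intervalIntegral.integral_const, smul_eq_mul, mul_one] at hm
        linarith only [hm, ht.2, hTs]
      linarith only [hpast, hpres]
    have hpos : 0 ≤ Real.exp (6 / 100 * K ^ 10) * (4 * C₁ * (1 + ε₀) ^ (-(n₀ : ℝ) / 2)) := by positivity
    have h2 := mul_le_mul_of_nonneg_left hint hpos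
    -- split the source integral of `c_one_ge_neg'`
    have hWc : ContinuousOn (fun s => (1 + ε₀) ^ ((5 : ℝ) / 2) * ε ^ 2 * Real.exp (-K ^ 10) *
        W 0 1 s ^ 2) (Icc (τ (n₀ - N)) Ts) :=
      continuousOn_const.mul ((h.continuousOn_W 0 1 le_rfl).pow 2)
    have hiW : IntervalIntegrable (fun s => (1 + ε₀) ^ ((5 : ℝ) / 2) * ε ^ 2 * Real.exp (-K ^ 10) *
        W 0 1 s ^ 2) volume (τ (n₀ - N)) t :=
      (hWc.mono (Icc_subset_Icc le_rfl ht.2)).intervalIntegrable_of_Icc (hτ00.trans ht.1)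
    have hiE : IntervalIntegrable (fun s => 4 * C₁ * (1 + ε₀) ^ (-(n₀ : ℝ) / 2) * Real.sqrt (Er 1 s))
        volume (τ (n₀ - N)) t := (hsi le_rfl (hτ00.trans ht.1) ht.2).const_mul _
    have hsplit : ∫ s in (τ (n₀ - N))..t, (4 * C₁ * (1 + ε₀) ^ (-(n₀ : ℝ) / 2) * Real.sqrt (Er 1 s) +
        (1 + ε₀) ^ ((5 : ℝ) / 2) * ε ^ 2 * Real.exp (-K ^ 10) * W 0 1 s ^ 2) =
        4 * C₁ * (1 + ε₀) ^ (-(n₀ : ℝ) / 2) * (∫ s in (τ (n₀ - N))..t, Real.sqrt (Er 1 s)) +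
        ∫ s in (τ (n₀ - N))..t, (1 + ε₀) ^ ((5 : ℝ) / 2) * ε ^ 2 * Real.exp (-K ^ 10) * W 0 1 s ^ 2 := by
      rw [intervalIntegral.integral_add hiE hiW, intervalIntegral.integral_const_mul]
    rw [hsplit] at h1
    simp only [hΞ] at h2 h1 ⊢
    linarith only [h1, h2]
  · -- (6.92): Gronwall for `d₁` on `[0, T⋆]`
    obtain ⟨α, hα⟩ : ∃ α : ℝ, α = 6 * Real.sqrt 2 * (ε ^ 2)⁻¹ * cM +
        4 * C₁ * (1 + ε₀) ^ (-(n₀ : ℝ) / 2) := ⟨_, rfl⟩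
    obtain ⟨β, hβ⟩ : ∃ β : ℝ, β = 36 * Real.sqrt 2 * K * (K ^ 15)⁻¹ := ⟨_, rfl⟩
    have hcM0 : 0 ≤ cM := (abs_nonneg _).trans (hc t ht)
    have hδ : 0 ≤ (1 + ε₀) ^ (-(n₀ : ℝ) / 2) := (Real.rpow_pos_of_pos h0 _).le
    have hα0 : 0 ≤ α := by rw [hα]; positivity
    have hβ0 : 0 ≤ β := by rw [hβ]; positivity
    have hq36 : (1 + ε₀) ^ ((5 : ℝ) / 2) * (1 + ε₀) ^ ((5 : ℝ) / 2) ≤ 36 := by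
      have h6' : 0 ≤ (1 + ε₀) ^ ((5 : ℝ) / 2) := (Real.rpow_pos_of_pos h0 _).le
      calc (1 + ε₀) ^ ((5 : ℝ) / 2) * (1 + ε₀) ^ ((5 : ℝ) / 2) ≤ 6 * 6 :=
            mul_le_mul hq6 hq6 h6' (by norm_num)
        _ = 36 := by norm_num
    have hbound : ∀ s ∈ Ico 0 Ts,
        |derivWithin (Xr 3 1) (Ici (τ (n₀ - N))) s| ≤ α + β * |Xr 3 1 s| := by
      intro s hs
      have hsI := Ico_subset_Icc_self hs
      have hτs : τ (n₀ - N) ≤ s := hτ00.trans hs.1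
      have h1 := h.d_one_linear' hw hτ00 hε hε₀ hε₀1 hK hC₁ ⟨hs.1, hs.2.le.trans hTw⟩ (hE1 s hsI) (hc s hsI)
      have h2 := h.d_one_rate_abs_le (by linarith) hKpos.le hτs
      -- the rate: `|(1+ε₀)^5 K a₂| ≤ 36 K √(2 Ẽ₂) ≤ 36 √2 K K^{-15} = β`
      have hsq : Real.sqrt (2 * Er 2 s) ≤ Real.sqrt 2 * (K ^ 15)⁻¹ := by
        rw [Real.sqrt_mul (by norm_num)]
        apply mul_le_mul_of_nonneg_left _ (Real.sqrt_nonneg _)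
        calc Real.sqrt (Er 2 s) ≤ Real.sqrt ((K ^ 30)⁻¹) := Real.sqrt_le_sqrt (hE2 s hsI)
          _ = (K ^ 15)⁻¹ := by
              rw [show (K ^ 30)⁻¹ = ((K ^ 15)⁻¹) ^ 2 by ring, Real.sqrt_sq (by positivity)]
      have hrate0 : |-((1 + ε₀) ^ ((5 : ℝ) / 2) * (1 + ε₀) ^ ((5 : ℝ) / 2) * K * Xr 0 2 s)| ≤ β := by
        refine h2.trans ?_
        rw [hβ]
        calc (1 + ε₀) ^ ((5 : ℝ) / 2) * (1 + ε₀) ^ ((5 : ℝ) / 2) * K * Real.sqrt (2 * Er 2 s)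
            ≤ 36 * K * (Real.sqrt 2 * (K ^ 15)⁻¹) :=
              mul_le_mul (mul_le_mul_of_nonneg_right hq36 hKpos.le) hsq (Real.sqrt_nonneg _)
                (by positivity)
          _ = 36 * Real.sqrt 2 * K * (K ^ 15)⁻¹ := by ring
      have hrate : |(-((1 + ε₀) ^ ((5 : ℝ) / 2) * (1 + ε₀) ^ ((5 : ℝ) / 2) * K * Xr 0 2 s)) * Xr 3 1 s| ≤
          β * |Xr 3 1 s| := by
        rw [abs_mul]
        exact mul_le_mul_of_nonneg_right hrate0 (abs_nonneg _)
      -- the constant part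
      have e1 : (1 + ε₀) ^ ((5 : ℝ) / 2) * (ε ^ 2)⁻¹ * cM * Real.sqrt 2 ≤
          6 * Real.sqrt 2 * (ε ^ 2)⁻¹ * cM := by
        have hnn : (0 : ℝ) ≤ (ε ^ 2)⁻¹ * cM * Real.sqrt 2 := by positivity
        calc (1 + ε₀) ^ ((5 : ℝ) / 2) * (ε ^ 2)⁻¹ * cM * Real.sqrt 2
            = (1 + ε₀) ^ ((5 : ℝ) / 2) * ((ε ^ 2)⁻¹ * cM * Real.sqrt 2) := by ring
          _ ≤ 6 * ((ε ^ 2)⁻¹ * cM * Real.sqrt 2) := mul_le_mul_of_nonneg_right hq6 hnn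
          _ = _ := by ring
      have e3 : C₁ * (1 + ε₀) ^ (2 - (n₀ : ℝ) / 2) ≤ 4 * C₁ * (1 + ε₀) ^ (-(n₀ : ℝ) / 2) := by
        have hsplit : (1 + ε₀) ^ (2 - (n₀ : ℝ) / 2) =
            (1 + ε₀) ^ (2 : ℝ) * (1 + ε₀) ^ (-(n₀ : ℝ) / 2) := by
          rw [← Real.rpow_add h0]; congr 1; ring
        have h4 : (1 + ε₀) ^ (2 : ℝ) ≤ 4 := by
          rw [show (2 : ℝ) = ((2 : ℕ) : ℝ) by norm_num, Real.rpow_natCast]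
          have h2' : 1 + ε₀ ≤ 2 := by linarith
          calc (1 + ε₀) ^ (2 : ℕ) ≤ 2 ^ (2 : ℕ) := pow_le_pow_left₀ h0.le h2' 2
            _ = 4 := by norm_num
        rw [hsplit]
        calc C₁ * ((1 + ε₀) ^ (2 : ℝ) * (1 + ε₀) ^ (-(n₀ : ℝ) / 2))
            = (1 + ε₀) ^ (2 : ℝ) * (C₁ * (1 + ε₀) ^ (-(n₀ : ℝ) / 2)) := by ring
          _ ≤ 4 * (C₁ * (1 + ε₀) ^ (-(n₀ : ℝ) / 2)) :=
              mul_le_mul_of_nonneg_right h4 (mul_nonneg hC₁ hδ)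
          _ = _ := by ring
      have hrhs : (1 + ε₀) ^ ((5 : ℝ) / 2) * (ε ^ 2)⁻¹ * cM * Real.sqrt 2 +
          C₁ * (1 + ε₀) ^ (2 - (n₀ : ℝ) / 2) ≤ α := by rw [hα]; linarith only [e1, e3]
      have htri := abs_sub_abs_le_abs_sub (derivWithin (Xr 3 1) (Ici (τ (n₀ - N))) s)
          ((-((1 + ε₀) ^ ((5 : ℝ) / 2) * (1 + ε₀) ^ ((5 : ℝ) / 2) * K * Xr 0 2 s)) * Xr 3 1 s)
      linarith only [htri, hrate, h1, hrhs]
    have hG := abs_le_of_abs_deriv_right_le_affine (h.continuousOn_X 3 1 hτ00)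
      (fun s hs => h.hasDeriv_X 3 1 (hτ00.trans hs.1)) hα0 hβ0 hbound t ht
    have hd0 := h.abs_d_one_zero_le hε₀ hKpos hN
    have ht100 : t ≤ 100 := ht.2.trans hTs
    have hexp : Real.exp (β * (t - 0)) ≤ Real.exp (3600 * Real.sqrt 2 * (K ^ 14)⁻¹) := by
      apply Real.exp_le_exp.2
      rw [sub_zero, hβ]
      have hK14 : K * (K ^ 15)⁻¹ = (K ^ 14)⁻¹ := by field_simp
      have : 0 ≤ Real.sqrt 2 * (K ^ 14)⁻¹ := by positivity
      calc 36 * Real.sqrt 2 * K * (K ^ 15)⁻¹ * t = 36 * (Real.sqrt 2 * (K ^ 14)⁻¹) * t := by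
            rw [← hK14]; ring
        _ ≤ 36 * (Real.sqrt 2 * (K ^ 14)⁻¹) * 100 := by
            apply mul_le_mul_of_nonneg_left ht100; positivity
        _ = 3600 * Real.sqrt 2 * (K ^ 14)⁻¹ := by ring
    have hinit : |Xr 3 1 0| + α * (t - 0) ≤ Real.sqrt 2 * (K ^ 15)⁻¹ + 100 * α := by
      rw [sub_zero]
      have : α * t ≤ α * 100 := mul_le_mul_of_nonneg_left ht100 hα0
      linarith only [this, hd0]
    have hfin : |Xr 3 1 t| ≤ (Real.sqrt 2 * (K ^ 15)⁻¹ + 100 * α) *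
        Real.exp (3600 * Real.sqrt 2 * (K ^ 14)⁻¹) :=
      hG.trans (mul_le_mul hinit hexp (Real.exp_pos _).le (by positivity))
    rw [hα, hcM] at hfin
    exact hfin

end Close

end Tao2016AveragedNS

end Literature.Analysis.FluidPDE
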